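import Literature.Topology.FourManifolds.HCobordismWallFilling
import Literature.Topology.FourManifolds.StabilisedSphereFilling
import Literature.Topology.FourManifolds.HCobordismKirbyRealisation
import Literature.Topology.FourManifolds.LatticeFormsEichlerFrames
import Literature.Topology.FourManifolds.LatticeFormsLagrangian
import HarnessLib

/-!
# Wall's trick: Theorem 2 for ALL even forms from the realisation of one summand's generators

Topic `Literature/Topology/FourManifolds`; fact seat of
`Literature.Topology.FourManifolds.isHCobordant_of_equivalent_intersectionForm` (**C. T. C. Wall,
*On simply-connected 4-manifolds*, J. London Math. Soc. 39 (1964) 141–149, Thm. 2**); sequel of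
`HCobordismKirbyRealisation.lean` (Thm. 2 from the realisation hypothesis (R) for cores with a
hyperbolic pair), `HCobordismWallFilling.lean` (Thm. 2 from a filling, F-A) and
`StabilisedSphereFilling.lean` (the standard filling of `𝕊⁴ # k(S² × S²)`, F-B).

THE TRICK (Wall's own §2 architecture, fed with Kirby's regluing instead of Thm. 1 + Lemma 2).
`HCobordismKirbyRealisation.lean` needs a hyperbolic pair INSIDE `Q_M` — the spare plane of the
last Eichler step — so definite (and `⟨1⟩ ⊕ ⟨-1⟩`, and zero) cores are out of its reach, the
realised group being transitive on full frames only up to a generation theorem (Wall 1963 /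
Kneser).  Wall never meets a core: his diffeomorphisms act on `∂V = #k(S² × S²)`.  Here, for
`Q_M` EVEN of rank `k ≥ 1`: the lattice of `N = M # (−M₂)` is `Q ⊥ (−Q) ≅ k·H` (the graph of the
isometry is a Lagrangian direct summand of half rank; Wall's normal form, even case) — CORE-FREE,
with a hyperbolic pair — so the (R)-theorem gives an h-cobordism `C : N ∼ P`, `P = 𝕊⁴ # k(S² × S²)`
(`…_of_evenBordism_of_realisedWallGenerators`, + Thom + the even spin-bordism step); `P = ∂V` for
the standard filling (F-B), whose dying classes are detected by `π₀ = (⟨βⱼ, ·⟩)ⱼ`; the Lagrangian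
mover on `P = P′ # S² × S²` comes from (R) for `P′ = 𝕊⁴ # (k−1)(S² × S²)` and the FULL-frame
transport of `LatticeFormsEichlerFrames.lean` (`Q_{P′} ≅ (k−1)·H` and `H` exhaust `Q_P`; the last
vector is finished by `1 ⊕ O(H)`); and F-A assembles Wall's `R = (V ∪_g C) ∪_N W₀`.

MAIN THEOREM `isHCobordant_of_equivalent_intersectionForm_of_isEven_of_realisedWallGenerators`:
**GIVEN (R), Thom's theorem and the even spin-bordism step, closed smooth simply connected
4-manifolds with isometric EVEN intersection forms of positive rank are h-cobordant** — no
hyperbolic pair, no indefiniteness, no generation theorem for `O(Q ⊕ H)`.  (Rank `0`, homotopy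
4-spheres, is not covered: there the pair `(N, 𝕊⁴)` has no hyperbolic pair either.)

Appended (§ZeroCore): the rank-`0` case (homotopy 4-spheres) by the FULL-frame regluing
`isHCobordant_of_isStabilization_of_realisedWallGenerators_of_zero` (the `k + 1` planes of
`Q_{P₁} = (k+1)·H` and `H` exhaust `Q_{P₂}`), whence Thm. 2 for ALL even forms from (R) + Thom +
the even spin-bordism step (`…_of_isEven_of_realisedWallGenerators'`) and from X.2 in place of
(R) (`…_of_isEven_of_thmX2_of_evenBordism`).

Everything is proved; no named fact and no definition is introduced.

## References

* C. T. C. Wall, *On simply-connected 4-manifolds*, J. London Math. Soc. 39 (1964) 141–149,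
  Thm. 2 and §2 pp. 144–146. [WallJLMS1964]
* R. C. Kirby, *The topology of 4-manifolds*, LNM 1374 (1989), Ch. X, proofs of Thm. 1
  (pp. 55–56) and Thm. 2 (pp. 61–62). [Kirby1989]
* V. Gritsenko, K. Hulek, G. K. Sankaran, J. Algebra 322 (2009) 463–478, Prop. 3.3.
  [GritsenkoHulekSankaran2009]
-/

noncomputable section

open scoped Manifold ContDiff Topology
open Set Function Module CategoryTheory CategoryTheory.Limits
open Literature.AlgebraicTopology.SingularHomology Literature.AlgebraicTopology.Homotopy
open LinearMap (BilinForm)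

namespace Literature.Topology.FourManifolds

/-- Local notation: `𝔼 n` is the model Euclidean space `EuclideanSpace ℝ (Fin n)`. -/
local notation "𝔼 " n:arg => EuclideanSpace ℝ (Fin n)

/-- Local notation: `𝕊 n` is the unit sphere in `EuclideanSpace ℝ (Fin (n + 1))`. -/
local notation "𝕊 " n:arg => (Metric.sphere (0 : EuclideanSpace ℝ (Fin (n + 1))) 1)

/-- Local notation: `Q⟦μ⟧` is the intersection form on `H²(·; ℤ)/T`. -/
local notation "Q⟦" μ "⟧" =>
  Literature.AlgebraicTopology.SingularHomology.intersectionForm two_add_two_eq_four μ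

/-! ### Algebra: hyperbolic bases -/

section HyperbolicBases

/-- **Bases with the same Gram matrix on two lattices give an isometry carrying one to the
other** (a bilinear form is determined by its values on a basis, `LinearMap.BilinForm.ext_basis`).
[folklore] -/
theorem exists_isometryEquiv_of_basis_gram_eq {ι V₁ V₂ : Type*} [AddCommGroup V₁] [Module ℤ V₁]
    [AddCommGroup V₂] [Module ℤ V₂] {B₁ : BilinForm ℤ V₁} {B₂ : BilinForm ℤ V₂}
    (v : Basis ι ℤ V₁) (w : Basis ι ℤ V₂) (hG : ∀ a c, B₁ (v a) (v c) = B₂ (w a) (w c)) :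
    ∃ T : B₁.IsometryEquiv B₂, ∀ a, T (v a) = w a := by
  have key : B₂.comp (v.equiv w (Equiv.refl ι)).toLinearMap (v.equiv w (Equiv.refl ι)).toLinearMap =
      B₁ := by
    refine LinearMap.BilinForm.ext_basis v fun a c => ?_
    simp only [LinearMap.BilinForm.comp_apply, LinearEquiv.coe_coe, Basis.equiv_apply,
      Equiv.refl_apply, hG]
  refine ⟨{ v.equiv w (Equiv.refl ι) with
    map_app' := fun x y => ?_ }, fun a => ?_⟩
  · change B₂ (v.equiv w (Equiv.refl ι) x) (v.equiv w (Equiv.refl ι) y) = B₁ x y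
    simpa only [LinearMap.BilinForm.comp_apply, LinearEquiv.coe_coe] using
      LinearMap.congr_fun₂ key x y
  · change v.equiv w (Equiv.refl ι) (v a) = w a
    simp

/-- **An even unimodular lattice with a Lagrangian direct summand `K` of half rank has a
hyperbolic basis whose first half spans `K`** — Wall's normal form (1964, p. 145:
"when the quadratic form is even, we can make `eᵢ' eⱼ' = 0`, also"; the tree's
`Lagrangian.exists_normalForm` with `o = none`). Any `ℤ`-module structure.
[cite: WallJLMS1964, §2, p. 145] -/
theorem exists_hyperbolicBasis_of_isEven {W : Type*} [AddCommGroup W] [inst : Module ℤ W]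
    [Module.Free ℤ W] [Module.Finite ℤ W] {B : BilinForm ℤ W} (hB : B.IsSymm)
    (hU : B.IsUnimodular) (hev : B.IsEven) {K : Submodule ℤ W}
    (hK : ∃ K' : Submodule ℤ W, IsCompl K K') (hKi : ∀ x ∈ K, ∀ y ∈ K, B x y = 0)
    (hKr : 2 * finrank ℤ K = finrank ℤ W) :
    ∃ b : Basis (Fin (finrank ℤ K) ⊕ Fin (finrank ℤ K)) ℤ W,
      (∀ i j, B (b (Sum.inl i)) (b (Sum.inl j)) = 0) ∧
      (∀ i j, B (b (Sum.inr i)) (b (Sum.inr j)) = 0) ∧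
      (∀ i j, B (b (Sum.inl i)) (b (Sum.inr j)) = if i = j then 1 else 0) ∧
      ∀ i, b (Sum.inl i) ∈ K := by
  obtain rfl : inst = AddCommGroup.toIntModule W := Subsingleton.elim _ _
  obtain ⟨K', hc⟩ := hK
  obtain ⟨b, o, hb, ho, hG⟩ := Lagrangian.exists_normalForm hB hU hc hKi hKr
  have hnone : o = none := ho.2 hev
  subst hnone
  refine ⟨b, hb.isotropic hKi, fun i j => ?_, hb.dual, hb.inl_mem⟩
  rw [hG]
  simp

/-- **The model hyperbolic basis of `(ℤ²)ᵐ`**: a basis `b₀` indexed by `Fin m ⊕ Fin m` with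
`b₀ (inl j) = eⱼ ⊗ (1, 0)`, `b₀ (inr j) = eⱼ ⊗ (0, 1)`. [folklore] -/
theorem exists_modelBasis (m : ℕ) :
    ∃ b₀ : Basis (Fin m ⊕ Fin m) ℤ (Fin m → Fin 2 → ℤ),
      (∀ j, b₀ (Sum.inl j) = Pi.single j (Pi.single 0 1)) ∧
      (∀ j, b₀ (Sum.inr j) = Pi.single j (Pi.single 1 1)) := by
  classical
  -- coordinates: `a ↦ (j ↦ a j 0) ⊔ (j ↦ a j 1)`
  let E₀ : (Fin m → Fin 2 → ℤ) ≃ₗ[ℤ] (Fin m ⊕ Fin m → ℤ) :=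
    { toFun := fun a => Sum.elim (fun j => a j 0) (fun j => a j 1)
      invFun := fun c j i => if i = 0 then c (Sum.inl j) else c (Sum.inr j)
      map_add' := fun a a' => by ext (j | j) <;> rfl
      map_smul' := fun c a => by ext (j | j) <;> rfl
      left_inv := fun a => by
        ext j i
        fin_cases i <;> simp
      right_inv := fun c => by
        ext (j | j) <;> simp }
  refine ⟨Basis.ofEquivFun E₀, fun j => ?_, fun j => ?_⟩
  · rw [Basis.coe_ofEquivFun]
    change (fun j' i => if i = 0 then (Pi.single (Sum.inl j) (1 : ℤ) : Fin m ⊕ Fin m → ℤ) (Sum.inl j')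
      else (Pi.single (Sum.inl j) (1 : ℤ) : Fin m ⊕ Fin m → ℤ) (Sum.inr j')) = _
    ext j' i
    fin_cases i
    · by_cases h : j' = j
      · subst h; simp
      · simp [h]
    · by_cases h : j' = j
      · subst h; simp
      · simp [h]
  · rw [Basis.coe_ofEquivFun]
    change (fun j' i => if i = 0 then (Pi.single (Sum.inr j) (1 : ℤ) : Fin m ⊕ Fin m → ℤ) (Sum.inl j')
      else (Pi.single (Sum.inr j) (1 : ℤ) : Fin m ⊕ Fin m → ℤ) (Sum.inr j')) = _
    ext j' i
    fin_cases i
    · by_cases h : j' = j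
      · subst h; simp
      · simp [h]
    · by_cases h : j' = j
      · subst h; simp
      · simp [h]

/-- **The spans of the two halves of a basis indexed by `Fin m ⊕ Fin m` are complementary**
(linear independence and spanning). [folklore] -/
theorem isCompl_span_inl_inr {W : Type*} [AddCommGroup W] [Module ℤ W] {m : ℕ}
    (b : Basis (Fin m ⊕ Fin m) ℤ W) :
    IsCompl (Submodule.span ℤ (Set.range (b ∘ Sum.inl))) (Submodule.span ℤ (Set.range (b ∘ Sum.inr))) := by
  have h1 : Set.range (b ∘ Sum.inl) = b '' Set.range Sum.inl := by
    rw [Set.range_comp]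
  have h2 : Set.range (b ∘ Sum.inr) = b '' (Set.range Sum.inl)ᶜ := by
    rw [Set.range_comp, Set.compl_range_inl]
  rw [h1, h2]
  refine ⟨b.linearIndependent.disjoint_span_image disjoint_compl_right, ?_⟩
  rw [codisjoint_iff, ← Submodule.span_union, ← Set.image_union, Set.union_compl_self,
    Set.image_univ, b.span_eq]

/-- The span of half a basis indexed by `Fin m ⊕ Fin m` has rank `m`. [folklore] -/
theorem finrank_span_inl {W : Type*} [AddCommGroup W] [Module ℤ W] {m : ℕ}
    (b : Basis (Fin m ⊕ Fin m) ℤ W) :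
    finrank ℤ (Submodule.span ℤ (Set.range (b ∘ Sum.inl))) = m := by
  have h := finrank_span_eq_card (R := ℤ) (b.linearIndependent.comp Sum.inl Sum.inl_injective)
  rw [Fintype.card_fin] at h
  convert h using 2
  exact Subsingleton.elim _ _

end HyperbolicBases

/-! ### The lattice of `P = 𝕊⁴ # k(S² × S²)` from the filling data -/

section SphereLattice

variable {P : Type} [TopologicalSpace P]

/-- **The hyperbolic basis `(βⱼ, β′ⱼ)` of `H²(P)/T`** for `P` a `k`-fold stabilisation of `𝕊⁴`,
from the identification `Θ : H²(𝕊⁴)/T ⊕ (ℤ²)ᵏ ≅ H²(P)/T` with `Q_P = k·H`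
(`exists_standardFilling_of_isStabilization_sphereFour` (iii)): `βⱼ = Θ(0, eⱼ ⊗ (1,0))`,
`β′ⱼ = Θ(0, eⱼ ⊗ (0,1))`, a basis (the first factor vanishes) with hyperbolic Gram matrix.
[cite: Kirby1989, Ch. X, proof of Thm. 1, pp. 55–56] -/
theorem exists_hyperbolicBasis_of_stabilisationData (μP : HomologicalOrientation ℤ P 4) {k : ℕ}
    (Θ : (↥(freeCohomology ℤ (𝕊 4) 2) × (Fin k → Fin 2 → ℤ)) ≃+ ↥(freeCohomology ℤ P 2))
    (hform : ∀ x y, Q⟦μP⟧ (Θ x) (Θ y) = ∑ j, hyperbolicForm (x.2 j) (y.2 j)) :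
    ∃ bP : Basis (Fin k ⊕ Fin k) ℤ ↥(freeCohomology ℤ P 2),
      (∀ j, bP (Sum.inl j) = Θ (0, Pi.single j (Pi.single 0 1))) ∧
      (∀ j, bP (Sum.inr j) = Θ (0, Pi.single j (Pi.single 1 1))) ∧
      (∀ i j, Q⟦μP⟧ (bP (Sum.inl i)) (bP (Sum.inl j)) = 0) ∧
      (∀ i j, Q⟦μP⟧ (bP (Sum.inr i)) (bP (Sum.inr j)) = 0) ∧
      (∀ i j, Q⟦μP⟧ (bP (Sum.inl i)) (bP (Sum.inr j)) = if i = j then 1 else 0) := by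
  -- `b ↦ Θ (0, b)` is a linear equivalence (the first factor is zero)
  have h0 : ∀ z : ↥(freeCohomology ℤ (𝕊 4) 2), z = 0 := freeCohomology_sphereFour_two_eq_zero
  let e : (Fin k → Fin 2 → ℤ) ≃ₗ[ℤ] ↥(freeCohomology ℤ P 2) :=
    { toFun := fun b => Θ (0, b)
      invFun := fun c => (Θ.symm c).2
      map_add' := fun b b' => by
        rw [← map_add, Prod.mk_add_mk, add_zero]
      map_smul' := fun c b => by
        have h := map_intCast_smul Θ.toAddMonoidHom ℤ ℤ c ((0 : ↥(freeCohomology ℤ (𝕊 4) 2)), b)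
        simp only [Int.cast_id, AddEquiv.coe_toAddMonoidHom, Prod.smul_mk] at h
        rw [show ((c • (0 : ↥(freeCohomology ℤ (𝕊 4) 2))), c • b) =
          ((0 : ↥(freeCohomology ℤ (𝕊 4) 2)), c • b) from Prod.ext (h0 _) rfl] at h
        simpa only [RingHom.id_apply] using h
      left_inv := fun b => by
        simp only [AddEquiv.symm_apply_apply]
      right_inv := fun c => by
        change Θ (0, (Θ.symm c).2) = c
        conv_rhs => rw [← Θ.apply_symm_apply c]
        congr 1
        exact Prod.ext (h0 _).symm rfl }
  have he : ∀ b, e b = Θ (0, b) := fun b => rfl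
  obtain ⟨b₀, hb₀l, hb₀r⟩ := exists_modelBasis k
  refine ⟨b₀.map e, fun j => by rw [Basis.map_apply, hb₀l, he], fun j => by rw [Basis.map_apply, hb₀r, he],
    fun i j => ?_, fun i j => ?_, fun i j => ?_⟩
  · rw [Basis.map_apply, Basis.map_apply, hb₀l, hb₀l, he, he, hform, sum_hyperbolicForm_single_single,
      hyperbolicForm_single_zero_self, ite_self]
  · rw [Basis.map_apply, Basis.map_apply, hb₀r, hb₀r, he, he, hform, sum_hyperbolicForm_single_single,
      hyperbolicForm_single_one_self, ite_self]
  · rw [Basis.map_apply, Basis.map_apply, hb₀l, hb₀r, he, he, hform, sum_hyperbolicForm_single_single,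
      hyperbolicForm_single_zero_single_one]

/-- **The annihilator of `ker π₀` is `span {βⱼ}`**: for a basis `bP` of `H²(P)/T` indexed by
`Fin k ⊕ Fin k` and the perfect Kronecker pairing of the closed simply connected `P`, a class `c`
pairing to zero with every `y ∈ H₂(P)` killed by all `⟨bP (inl j), ·⟩` lies in the span of the
`bP (inl j)` (test against the homology classes dual to the coordinates `inr j`). [folklore] -/
theorem mem_span_inl_of_forall_kronecker [CompactSpace P] [T2Space P] [ChartedSpace (𝔼 4) P]
    [SimplyConnectedSpace P] {k : ℕ} (bP : Basis (Fin k ⊕ Fin k) ℤ ↥(freeCohomology ℤ P 2))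
    (c : ↥(freeCohomology ℤ P 2))
    (hc : ∀ y : singularHomology ℤ ℤ P 2,
      (∀ j, freeKroneckerPairing P 2 (bP (Sum.inl j)) y = 0) → freeKroneckerPairing P 2 c y = 0) :
    c ∈ Submodule.span ℤ (Set.range (bP ∘ Sum.inl)) := by
  classical
  haveI := isPerfPair_freeKroneckerPairing_two P
  -- the homology classes `y_j` dual to the coordinates `inr j`
  have hcoord : ∀ j, bP.repr c (Sum.inr j) = 0 := by
    intro j
    obtain ⟨y, hy⟩ := (LinearMap.IsPerfPair.bijective_right (freeKroneckerPairing P 2)).2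
      (bP.coord (Sum.inr j))
    have hy' : ∀ c', freeKroneckerPairing P 2 c' y = bP.repr c' (Sum.inr j) := fun c' => by
      have h := LinearMap.congr_fun hy c'
      simpa only [LinearMap.flip_apply, Basis.coord_apply] using h
    rw [← hy']
    refine hc y fun i => ?_
    rw [hy', Basis.repr_self, Finsupp.single_apply, if_neg Sum.inl_ne_inr]
  rw [Set.range_comp, Basis.mem_span_image]
  intro i hi
  rcases i with i | j
  · exact ⟨i, rfl⟩
  · exact absurd (hcoord j) (Finsupp.mem_support_iff.1 hi)

end SphereLattice

/-! ### The lattice of `N = M₁ # (−M₂)` for even `Q`: `Q ⊥ (−Q) ≅ k·H`, with a hyperbolic pair -/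

section ConnectedSumLattice

/-- **`Q ⊥ (−Q) ≅ k·H` for even unimodular `Q` of rank `k`, explicitly**: if the lattice
`H²(N)/T` of a closed `ℤ`-oriented `N` splits as `H²(M₁)/T ⊕ H²(M₂)/T` with
`Q_N = Q⟦μ⟧ ⊕ (−Q⟦ν⟧)`, `Q⟦μ⟧ ≅ Q⟦ν⟧` (isometry `α`) and `Q⟦μ⟧` even, then for every lattice
with a hyperbolic basis indexed by `Fin k ⊕ Fin k`, `k = rank H²(M₁)/T` (e.g. `H²(P)/T`,
`P = 𝕊⁴ # k(S² × S²)`), `Q_N` is isometric to it, and (for `k ≥ 1`) `Q_N` contains a hyperbolic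
pair.  Proof: the graph of `α` is a Lagrangian direct summand of half rank
(`graphSubmodule_lagrangian`, Wall p. 144), `Q_N` is even, so Wall's normal form is hyperbolic
(`exists_hyperbolicBasis_of_isEven`), and bases with equal Gram matrices give an isometry.
[cite: WallJLMS1964, §2 pp. 144–145] -/
theorem exists_isometryEquiv_of_splitting_of_isEven {M₁ M₂ N W : Type} [TopologicalSpace M₁]
    [TopologicalSpace M₂] [TopologicalSpace N] [CompactSpace N] [T2Space N] [ChartedSpace (𝔼 4) N]
    [SimplyConnectedSpace N]
    (μ : HomologicalOrientation ℤ M₁ 4) (ν : HomologicalOrientation ℤ M₂ 4)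
    (π : HomologicalOrientation ℤ N 4)
    [Module.Free ℤ ↥(freeCohomology ℤ M₁ 2)] [Module.Finite ℤ ↥(freeCohomology ℤ M₁ 2)]
    [Module.Free ℤ ↥(freeCohomology ℤ M₂ 2)] [Module.Finite ℤ ↥(freeCohomology ℤ M₂ 2)]
    {sM : ↥(freeCohomology ℤ N 2) →ₗ[ℤ] ↥(freeCohomology ℤ M₁ 2)}
    {sN : ↥(freeCohomology ℤ N 2) →ₗ[ℤ] ↥(freeCohomology ℤ M₂ 2)}
    (hst : Function.Bijective fun x => (sM x, sN x))
    (hQ : ∀ x y, Q⟦π⟧ x y = Q⟦μ⟧ (sM x) (sM y) - Q⟦ν⟧ (sN x) (sN y))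
    (α : (Q⟦μ⟧).IsometryEquiv (Q⟦ν⟧)) (heven : (Q⟦μ⟧).IsEven)
    [AddCommGroup W] [Module ℤ W] {B : BilinForm ℤ W} (hBsymm : B.IsSymm) {k : ℕ}
    (hk : finrank ℤ ↥(freeCohomology ℤ M₁ 2) = k) (bP : Basis (Fin k ⊕ Fin k) ℤ W)
    (hll : ∀ i j, B (bP (Sum.inl i)) (bP (Sum.inl j)) = 0)
    (hrr : ∀ i j, B (bP (Sum.inr i)) (bP (Sum.inr j)) = 0)
    (hlr : ∀ i j, B (bP (Sum.inl i)) (bP (Sum.inr j)) = if i = j then 1 else 0) :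
    Nonempty ((Q⟦π⟧).IsometryEquiv B) ∧
      (0 < k → ∃ e f : ↥(freeCohomology ℤ N 2), Q⟦π⟧ e e = 0 ∧ Q⟦π⟧ f f = 0 ∧ Q⟦π⟧ e f = 1) := by
  classical
  -- the lattice of `N`: finitely generated free, `Q_N` symmetric unimodular even
  obtain ⟨hfinN, hfreeN⟩ := finite_and_free_freeCohomology_two (M := N)
  haveI := hfinN
  haveI := hfreeN
  have hsymm : (Q⟦π⟧).IsSymm :=
    isSymm_intersectionForm (cupProduct_gradedComm_holds ℤ N) even_two two_add_two_eq_four π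
  have hU : (Q⟦π⟧).IsUnimodular := isPerfPair_intersectionForm_four_of_compactSpace (M := N) π
  have hevν : (Q⟦ν⟧).IsEven := fun y => by
    have h := α.map_app (α.symm y) (α.symm y)
    rw [LinearMap.BilinForm.IsometryEquiv.apply_symm_apply] at h
    rw [h]
    exact heven _
  have hev : (Q⟦π⟧).IsEven := fun x => by
    rw [hQ]
    exact (heven _).sub (hevν _)
  -- the graph of `α`: a Lagrangian direct summand of half rank, of rank `k`
  obtain ⟨hKc, hKi, hKr⟩ := graphSubmodule_lagrangian hst hQ α
  have hrankN : finrank ℤ ↥(freeCohomology ℤ N 2) =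
      finrank ℤ ↥(freeCohomology ℤ M₁ 2) + finrank ℤ ↥(freeCohomology ℤ M₂ 2) := by
    letI : Module ℤ (↥(freeCohomology ℤ M₁ 2) × ↥(freeCohomology ℤ M₂ 2)) := Prod.instModule
    have e := (LinearEquiv.ofBijective (sM.prod sN) hst).finrank_eq
    rw [Module.finrank_prod] at e
    exact e
  have hrank₂ : finrank ℤ ↥(freeCohomology ℤ M₂ 2) = finrank ℤ ↥(freeCohomology ℤ M₁ 2) :=
    α.toLinearEquiv.finrank_eq.symm
  have hKk : finrank ℤ ↥(graphSubmodule sM sN (α : _ →ₗ[ℤ] _)) = k := by omega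
  obtain ⟨b, hbl, hbr, hblr, -⟩ := exists_hyperbolicBasis_of_isEven hsymm hU hev hKc hKi hKr
  -- reindex to `Fin k ⊕ Fin k` and compare Gram matrices
  set b' := b.reindex (Equiv.sumCongr (finCongr hKk) (finCongr hKk)) with hb'
  have hb'l : ∀ i, b' (Sum.inl i) = b (Sum.inl ((finCongr hKk).symm i)) := fun i => by
    rw [hb', Basis.reindex_apply]; rfl
  have hb'r : ∀ i, b' (Sum.inr i) = b (Sum.inr ((finCongr hKk).symm i)) := fun i => by
    rw [hb', Basis.reindex_apply]; rfl
  have hG : ∀ a c, Q⟦π⟧ (b' a) (b' c) = B (bP a) (bP c) := by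
    rintro (i | i) (j | j)
    · rw [hb'l, hb'l, hbl, hll]
    · rw [hb'l, hb'r, hblr, hlr]
      simp only [Equiv.apply_eq_iff_eq]
    · rw [hb'r, hb'l, hsymm.eq, hblr, hBsymm.eq, hlr]
      simp only [Equiv.apply_eq_iff_eq]
    · rw [hb'r, hb'r, hbr, hrr]
  obtain ⟨T, -⟩ := exists_isometryEquiv_of_basis_gram_eq b' bP hG
  refine ⟨⟨T⟩, fun hkpos => ?_⟩
  · refine ⟨b' (Sum.inl ⟨0, hkpos⟩), b' (Sum.inr ⟨0, hkpos⟩), ?_, ?_, ?_⟩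
    · rw [hb'l, hbl]
    · rw [hb'r, hbr]
    · rw [hb'l, hb'r, hblr, if_pos rfl]

end ConnectedSumLattice

/-! ### The Lagrangian mover on `P = 𝕊⁴ # (m+1)(S² × S²)` from (R) for `𝕊⁴ # m(S² × S²)` -/

section Mover

/-- **The Lagrangian mover on `𝕊⁴ # (m+1)(S² × S²)` from the realisation of Kirby's generators
of the last summand.**  Let `X` be an `m`-fold stabilisation of `𝕊⁴`, `P = X # S² × S²`, `μP` an
orientation of `P` and `bP` a basis of `H²(P)/T` indexed by `Fin (m+1) ⊕ Fin (m+1)` with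
hyperbolic Gram matrix (e.g. from `exists_hyperbolicBasis_of_stabilisationData`).  GIVEN (R)
(`hR`, the hypothesis of `HCobordismKirbyRealisation.lean`), every direct summand `K ⊆ H²(P)/T`
of half rank isotropic for `Q⟦β⟧` (any orientation `β`) is carried onto `span {bP (inl j)}` by a
diffeomorphism: `β = ±μP`; Wall's algebraic lemma gives an isometry `T` of `Q⟦μP⟧` with
`T(K) = L` (`exists_isometryEquiv_map_eq_of_isotropic`, p. 145); (R) for `(X, P)` — `Q_X` is
indefinite for `m ≥ 1` and of rank `0` for `m = 0` — gives `Θ : Q ⊕ H ≅ Q_P` with realised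
conjugated generators, `Q ≅ Q_X` an abstract copy; in `Q ⊕ H` the `m` hyperbolic planes of
`Q_X ≅ m·H` and `H` exhaust the lattice, so the FULL-frame transport
(`exists_isWordIn_wallGenerators_apply_eq_of_fullFrame`) yields a word `φ` in the generators
agreeing with `Θ⁻¹ T Θ` on the pulled-back half-frame `Θ⁻¹ T⁻¹ (bP (inl j))`, and the
diffeomorphism realising `Θ φ Θ⁻¹` (`isRealisedByDiffeomorph_conj_of_isWordIn`) carries
`K = T⁻¹ L` onto `L`. [cite: WallJLMS1964, §2, p. 145] [cite: Kirby1989, Ch. X, proof of Thm. 2 (pp. 61–62)] -/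
theorem exists_lagrangianMover_of_realisedWallGenerators
    (hR : ∀ (X : Type) [TopologicalSpace X] [T2Space X] [SecondCountableTopology X]
      [ChartedSpace (𝔼 4) X] [CompactSpace X] [IsManifold (𝓡 4) ∞ X] [SimplyConnectedSpace X]
      (ξ : HomologicalOrientation ℤ X 4)
      (_hX : (Q⟦ξ⟧).IsIndefinite ∨ Module.finrank ℤ ↥(freeCohomology ℤ X 2) ≤ 8)
      (Y : Type) [TopologicalSpace Y] [T2Space Y] [SecondCountableTopology Y]
      [ChartedSpace (𝔼 4) Y] [CompactSpace Y] [IsManifold (𝓡 4) ∞ Y]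
      (_hY : IsConnectedSum (𝓡 4) (𝓡 4) ((𝓡 2).prod (𝓡 2)) X ((𝕊 2) × (𝕊 2)) Y)
      (υ : HomologicalOrientation ℤ Y 4) (V : Type) [AddCommGroup V] (Q : BilinForm ℤ V)
      (hQ : Q.IsSymm) (_e : Q.IsometryEquiv (Q⟦ξ⟧))
      (_Θ₀ : (Q.prod hyperbolicForm).IsometryEquiv (Q⟦υ⟧)),
      ∃ Θ : (Q.prod hyperbolicForm).IsometryEquiv (Q⟦υ⟧),
        ∀ s ∈ wallGenerators hQ, IsRealisedByDiffeomorph υ (Θ.symm.trans (s.trans Θ)))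
    {m : ℕ} {X : Type} [TopologicalSpace X] [T2Space X] [SecondCountableTopology X]
    [ChartedSpace (𝔼 4) X] [CompactSpace X] [IsManifold (𝓡 4) ∞ X] [SimplyConnectedSpace X]
    (hX : IsStabilization m (𝕊 4) X)
    {P : Type} [TopologicalSpace P] [T2Space P] [SecondCountableTopology P]
    [ChartedSpace (𝔼 4) P] [CompactSpace P] [IsManifold (𝓡 4) ∞ P] [SimplyConnectedSpace P]
    (hCS : IsConnectedSum (𝓡 4) (𝓡 4) ((𝓡 2).prod (𝓡 2)) X ((𝕊 2) × (𝕊 2)) P)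
    (μP : HomologicalOrientation ℤ P 4)
    (bP : Basis (Fin (m + 1) ⊕ Fin (m + 1)) ℤ ↥(freeCohomology ℤ P 2))
    (hll : ∀ i j, Q⟦μP⟧ (bP (Sum.inl i)) (bP (Sum.inl j)) = 0)
    (hrr : ∀ i j, Q⟦μP⟧ (bP (Sum.inr i)) (bP (Sum.inr j)) = 0)
    (hlr : ∀ i j, Q⟦μP⟧ (bP (Sum.inl i)) (bP (Sum.inr j)) = if i = j then 1 else 0)
    (β : HomologicalOrientation ℤ P 4) (K : Submodule ℤ ↥(freeCohomology ℤ P 2))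
    (hKc : ∃ K' : Submodule ℤ ↥(freeCohomology ℤ P 2), IsCompl K K')
    (hKi : ∀ x ∈ K, ∀ y ∈ K, Q⟦β⟧ x y = 0)
    (hKr : 2 * finrank ℤ K = finrank ℤ ↥(freeCohomology ℤ P 2)) :
    ∃ g : P ≃ₘ⟮𝓡 4, 𝓡 4⟯ P,
      Submodule.map (freeCohomology.map (R := ℤ) (⟨g, g.continuous⟩ : C(P, P)) 2) K =
        Submodule.span ℤ (Set.range (bP ∘ Sum.inl)) := by
  classical
  haveI : SimplyConnectedSpace (𝕊 4) := simplyConnectedSpace_euclideanSphere (n := 4) (by norm_num)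
  set L := Submodule.span ℤ (Set.range (bP ∘ Sum.inl)) with hLdef
  -- the lattice of `P`
  obtain ⟨hfinP, hfreeP⟩ := finite_and_free_freeCohomology_two (M := P)
  haveI := hfinP
  haveI := hfreeP
  have hsymmP : (Q⟦μP⟧).IsSymm :=
    isSymm_intersectionForm (cupProduct_gradedComm_holds ℤ P) even_two two_add_two_eq_four μP
  have hUP : (Q⟦μP⟧).IsUnimodular := isPerfPair_intersectionForm_four_of_compactSpace (M := P) μP
  -- `β = ± μP`: `K` is isotropic for `Q⟦μP⟧`
  have hKi' : ∀ x ∈ K, ∀ y ∈ K, Q⟦μP⟧ x y = 0 := by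
    rcases HomologicalOrientation.eq_or_eq_neg_of_connected_holds P β μP with rfl | rfl
    · exact hKi
    · intro x hx y hy
      have h := hKi x hx y hy
      rw [intersectionForm_neg (HomologicalOrientation.fundamentalClass_neg_holds ℤ P 4)
        two_add_two_eq_four μP, LinearMap.neg_apply, LinearMap.neg_apply, neg_eq_zero] at h
      exact h
  -- `L` is a Lagrangian direct summand of half rank
  have hLc : ∃ L' : Submodule ℤ ↥(freeCohomology ℤ P 2), IsCompl L L' := ⟨_, isCompl_span_inl_inr bP⟩
  have hLi : ∀ x ∈ L, ∀ y ∈ L, Q⟦μP⟧ x y = 0 := by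
    intro x hx y hy
    refine Submodule.span_induction (p := fun y _ => Q⟦μP⟧ x y = 0) ?_ ?_ ?_ ?_ hy
    · rintro _ ⟨j, rfl⟩
      refine Submodule.span_induction (p := fun x _ => Q⟦μP⟧ x (bP (Sum.inl j)) = 0) ?_ ?_ ?_ ?_ hx
      · rintro _ ⟨i, rfl⟩
        exact hll i j
      · rw [map_zero, LinearMap.zero_apply]
      · intro a b _ _ ha hb
        rw [map_add, LinearMap.add_apply, ha, hb, add_zero]
      · intro c a _ ha
        rw [LinearMap.BilinForm.smul_left, ha, mul_zero]
    · rw [map_zero]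
    · intro a b _ _ ha hb
      rw [map_add, ha, hb, add_zero]
    · intro c a _ ha
      rw [LinearMap.BilinForm.smul_right, ha, mul_zero]
  have hrankP : finrank ℤ ↥(freeCohomology ℤ P 2) = (m + 1) + (m + 1) := by
    rw [finrank_eq_card_basis bP, Fintype.card_sum, Fintype.card_fin]
  have hLr : 2 * finrank ℤ L = finrank ℤ ↥(freeCohomology ℤ P 2) := by
    rw [hLdef, finrank_span_inl bP, hrankP]; ring
  -- Wall's lemma: `T(K) = L`
  obtain ⟨T, hT⟩ := exists_isometryEquiv_map_eq_of_isotropic hsymmP hUP hKc hKi' hKr hLc hLi hLr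
  -- the lattice data of `P = X # S² × S²` (one-fold) and of `X = 𝕊⁴ # m(S² × S²)`
  obtain ⟨ξ₀⟩ := isOrientableOver_of_simplyConnectedSpace ℤ X (n := 4)
  obtain ⟨μS⟩ := isOrientableOver_of_simplyConnectedSpace ℤ (𝕊 4) (n := 4)
  have h1 : IsStabilization 1 X P := (isStabilization_zero_self X).succ hCS
  obtain ⟨-, -, -, hdata1⟩ := exists_stabilisationCobordism 1 X P h1
  obtain ⟨-, -, Θone, -, ξ₁, -, -, -, -, -, -, -, hΘone⟩ := hdata1 ξ₀ μP
  obtain ⟨-, -, -, hdataX⟩ := exists_stabilisationCobordism m (𝕊 4) X hX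
  obtain ⟨-, -, ΘX, -, μS', -, -, -, -, -, -, -, hΘX⟩ := hdataX μS ξ₁
  have hΘX0 : ∀ c c' : Fin m → Fin 2 → ℤ,
      Q⟦ξ₁⟧ (ΘX (0, c)) (ΘX (0, c')) = ∑ j, hyperbolicForm (c j) (c' j) := fun c c' => by
    rw [hΘX]
    simp
  -- `Q_X` indefinite (`m ≥ 1`) or of rank `0` (`m = 0`)
  obtain ⟨hfinX, hfreeX⟩ := finite_and_free_freeCohomology_two (M := X)
  haveI := hfinX
  haveI := hfreeX
  have hXind : (Q⟦ξ₁⟧).IsIndefinite ∨ Module.finrank ℤ ↥(freeCohomology ℤ X 2) ≤ 8 := by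
    cases m with
    | zero =>
      right
      have hsub : Subsingleton ↥(freeCohomology ℤ X 2) := by
        refine ⟨fun a b => ?_⟩
        rw [← ΘX.apply_symm_apply a, ← ΘX.apply_symm_apply b]
        congr 1
        exact Prod.ext ((freeCohomology_sphereFour_two_eq_zero _).trans
          (freeCohomology_sphereFour_two_eq_zero _).symm) (funext fun j => j.elim0)
      rw [Module.finrank_zero_of_subsingleton]
      exact Nat.zero_le _
    | succ m => exact Or.inl (isIndefinite_of_stabilisationForm μS' ξ₁ ΘX hΘX)
  have hsymmX : (Q⟦ξ₁⟧).IsSymm :=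
    isSymm_intersectionForm (cupProduct_gradedComm_holds ℤ X) even_two two_add_two_eq_four ξ₁
  have hUX : (Q⟦ξ₁⟧).IsUnimodular := isPerfPair_intersectionForm_four_of_compactSpace (M := X) ξ₁
  /- an abstract copy `(V, Q)` of the lattice `Q_X` (coordinates in a basis, as an opaque
  additive group), as in `HCobordismKirbyRealisation.lean` -/
  obtain ⟨V, instV, g, Q, hQg⟩ : ∃ (V : Type) (_ : AddCommGroup V)
      (g : V ≃+ ↥(freeCohomology ℤ X 2)) (Q : BilinForm ℤ V), ∀ a b, Q a b = Q⟦ξ₁⟧ (g a) (g b) :=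
    ⟨(Module.Free.ChooseBasisIndex ℤ ↥(freeCohomology ℤ X 2) → ℤ), inferInstance,
      (Module.Free.chooseBasis ℤ ↥(freeCohomology ℤ X 2)).equivFun.symm.toAddEquiv,
      (Q⟦ξ₁⟧).comp (Module.Free.chooseBasis ℤ ↥(freeCohomology ℤ X 2)).equivFun.symm.toLinearMap
        (Module.Free.chooseBasis ℤ ↥(freeCohomology ℤ X 2)).equivFun.symm.toLinearMap,
      fun a b => LinearMap.BilinForm.comp_apply _ _ _ a b⟩
  have hQe : ∀ a b, Q (g.symm a) (g.symm b) = Q⟦ξ₁⟧ a b := fun a b => by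
    simp only [hQg, AddEquiv.apply_symm_apply]
  have hQ' : Q.IsSymm := ⟨fun a b => by simp only [hQg]; exact hsymmX.eq _ _⟩
  let Lg : V ≃ₗ[ℤ] ↥(freeCohomology ℤ X 2) :=
    { g with
      map_smul' := fun c x => by
        simpa only [Int.cast_id, RingHom.id_apply, AddEquiv.coe_toAddMonoidHom,
          AddEquiv.toFun_eq_coe] using map_intCast_smul g.toAddMonoidHom ℤ ℤ c x }
  let eIso : Q.IsometryEquiv (Q⟦ξ₁⟧) :=
    { Lg with
      map_app' := fun a b => by
        change Q⟦ξ₁⟧ (g a) (g b) = Q a b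
        exact (hQg a b).symm }
  obtain ⟨Θ₀⟩ := nonempty_isometryEquiv_of_stabilisationForm_one ξ₁ μP Θone hΘone Q g
    fun a b => (hQg a b).symm
  -- (R) for `P = X # S² × S²`
  obtain ⟨Θ, hSΘ⟩ := hR X ξ₁ hXind P hCS μP V Q hQ' eIso Θ₀
  have hB : (Q.prod hyperbolicForm).IsSymm := hQ'.prod isSymm_hyperbolicForm
  -- the `m` target planes of `Q_X ≅ m·H`, inside the summand `Q`
  set xs : Fin m → V × (Fin 2 → ℤ) := fun j => (g.symm (ΘX (0, Pi.single j (Pi.single 0 1))), 0)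
    with hxs
  set ys : Fin m → V × (Fin 2 → ℤ) := fun j => (g.symm (ΘX (0, Pi.single j (Pi.single 1 1))), 0)
    with hys
  have hvv : ∀ (a b : Fin 2) (i j : Fin m),
      Q.prod hyperbolicForm ((g.symm (ΘX (0, Pi.single i (Pi.single a 1))), 0))
          ((g.symm (ΘX (0, Pi.single j (Pi.single b 1))), 0)) =
        if i = j then hyperbolicForm (Pi.single a 1 : Fin 2 → ℤ) (Pi.single b 1) else 0 := by
    intro a b i j
    rw [prod_hyperbolic_inl_inl, hQe, hΘX0, sum_hyperbolicForm_single_single]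
  have hxx : ∀ i j, Q.prod hyperbolicForm (xs i) (xs j) = 0 := fun i j => by
    rw [hxs, hvv, hyperbolicForm_single_zero_self, ite_self]
  have hyy : ∀ i j, Q.prod hyperbolicForm (ys i) (ys j) = 0 := fun i j => by
    rw [hys, hvv, hyperbolicForm_single_one_self, ite_self]
  have hxy : ∀ i j, Q.prod hyperbolicForm (xs i) (ys j) = if i = j then 1 else 0 := fun i j => by
    rw [hxs, hys, hvv, hyperbolicForm_single_zero_single_one]
  have hxX : ∀ j, Q.prod hyperbolicForm (xs j) hypX = 0 := fun j => prod_hyperbolic_inl_hypX Q _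
  have hxY : ∀ j, Q.prod hyperbolicForm (xs j) hypY = 0 := fun j => prod_hyperbolic_inl_hypY Q _
  have hyX : ∀ j, Q.prod hyperbolicForm (ys j) hypX = 0 := fun j => prod_hyperbolic_inl_hypX Q _
  have hyY : ∀ j, Q.prod hyperbolicForm (ys j) hypY = 0 := fun j => prod_hyperbolic_inl_hypY Q _
  -- the planes and `H` exhaust `Q ⊕ H`
  obtain ⟨b₀, hb₀l, hb₀r⟩ := exists_modelBasis m
  let eX : (Fin m → Fin 2 → ℤ) →ₗ[ℤ] ↥(freeCohomology ℤ X 2) :=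
    { toFun := fun c => ΘX (0, c)
      map_add' := fun c c' => by rw [← map_add, Prod.mk_add_mk, add_zero]
      map_smul' := fun n c => by
        have h := map_intCast_smul ΘX.toAddMonoidHom ℤ ℤ n ((0 : ↥(freeCohomology ℤ (𝕊 4) 2)), c)
        simp only [Int.cast_id, AddEquiv.coe_toAddMonoidHom, Prod.smul_mk] at h
        rw [show ((n • (0 : ↥(freeCohomology ℤ (𝕊 4) 2))), n • c) =
          ((0 : ↥(freeCohomology ℤ (𝕊 4) 2)), n • c) from
            Prod.ext (freeCohomology_sphereFour_two_eq_zero _) rfl] at h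
        simpa only [RingHom.id_apply] using h }
  have heX : ∀ c, eX c = ΘX (0, c) := fun c => rfl
  have hspan : ∀ v : V × (Fin 2 → ℤ), (∀ j, Q.prod hyperbolicForm v (xs j) = 0) →
      (∀ j, Q.prod hyperbolicForm v (ys j) = 0) → Q.prod hyperbolicForm v hypX = 0 →
      Q.prod hyperbolicForm v hypY = 0 → v = 0 := by
    intro v hvx hvy hvX hvY
    have hv : v = (v.1, 0) := eq_inl_fst_of_ortho_hyp hvX hvY
    -- the functional `Q_X (g v₁) ∘ ΘX (0, ·)` vanishes on the model basis, hence everywhere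
    have hF : (Q⟦ξ₁⟧ (g v.1)).comp eX = 0 := by
      refine b₀.ext fun a => ?_
      rw [LinearMap.zero_apply, LinearMap.comp_apply, heX]
      rcases a with j | j
      · rw [hb₀l, ← hQe, g.symm_apply_apply, ← prod_hyperbolic_inl_inl (Q := Q), ← hv]
        exact hvx j
      · rw [hb₀r, ← hQe, g.symm_apply_apply, ← prod_hyperbolic_inl_inl (Q := Q), ← hv]
        exact hvy j
    have hzero : Q⟦ξ₁⟧ (g v.1) = 0 := by
      ext w
      rw [LinearMap.zero_apply, ← ΘX.apply_symm_apply w]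
      have hw : ΘX.symm w = (0, (ΘX.symm w).2) := Prod.ext (freeCohomology_sphereFour_two_eq_zero _) rfl
      rw [hw, ← heX, ← LinearMap.comp_apply, hF, LinearMap.zero_apply]
    have hv1 : v.1 = 0 := by
      haveI : (Q⟦ξ₁⟧).IsPerfPair := hUX
      have h := (LinearMap.IsPerfPair.bijective_left (Q⟦ξ₁⟧)).1 (hzero.trans (map_zero _).symm)
      rw [← g.symm_apply_apply v.1, h, map_zero]
    rw [hv, hv1]
    rfl
  -- the frame `T⁻¹ (bP)` pulled back along `Θ`, and the isometry `A = Θ⁻¹ T Θ`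
  set A : (Q.prod hyperbolicForm).IsometryEquiv (Q.prod hyperbolicForm) := Θ.trans (T.trans Θ.symm)
    with hA
  set u : Fin (m + 1) → V × (Fin 2 → ℤ) := fun l => Θ.symm (T.symm (bP (Sum.inl l))) with hu₀
  set u' : Fin (m + 1) → V × (Fin 2 → ℤ) := fun l => Θ.symm (T.symm (bP (Sum.inr l))) with hu₀'
  have hu : ∀ i j, Q.prod hyperbolicForm (u i) (u j) = 0 := fun i j => by
    rw [hu₀, Θ.symm.map_app, T.symm.map_app, hll]
  have hu' : ∀ i j, Q.prod hyperbolicForm (u' i) (u' j) = 0 := fun i j => by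
    rw [hu₀', Θ.symm.map_app, T.symm.map_app, hrr]
  have huu' : ∀ i j, Q.prod hyperbolicForm (u i) (u' j) = if i = j then 1 else 0 := fun i j => by
    rw [hu₀, hu₀', Θ.symm.map_app, T.symm.map_app, hlr]
  obtain ⟨φ, hφ, hφu⟩ := exists_isWordIn_wallGenerators_apply_eq_of_fullFrame hQ' hxx hyy hxy hxX
    hxY hyX hyY hspan A u u' hu hu' huu'
  -- the diffeomorphism realising `Θ φ Θ⁻¹`
  obtain ⟨gd, hgd⟩ := isRealisedByDiffeomorph_conj_of_isWordIn μP hQ' Θ hSΘ hφ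
  have hgdb : ∀ l, freeCohomology.map (R := ℤ) (⟨gd, gd.continuous⟩ : C(P, P)) 2
      (T.symm (bP (Sum.inl l))) = bP (Sum.inl l) := fun l => by
    rw [hgd, LinearMap.BilinForm.IsometryEquiv.trans_apply, LinearMap.BilinForm.IsometryEquiv.trans_apply]
    change Θ (φ (u l)) = _
    rw [hφu, hA, LinearMap.BilinForm.IsometryEquiv.trans_apply,
      LinearMap.BilinForm.IsometryEquiv.trans_apply, hu₀]
    simp only [LinearMap.BilinForm.IsometryEquiv.apply_symm_apply]
  refine ⟨gd, ?_⟩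
  -- `g^*(K) = g^*(T⁻¹ L) = L`
  have hK : K = Submodule.map (T.symm.toLinearEquiv : _ →ₗ[ℤ] _) L := by
    rw [← hT, ← Submodule.map_comp]
    conv_lhs => rw [← Submodule.map_id K]
    congr 1
    ext x
    simp
  rw [hK, ← Submodule.map_comp, hLdef, Submodule.map_span, ← Set.range_comp]
  congr 1
  ext x
  simp only [Set.mem_range, Function.comp_apply, LinearMap.coe_comp, LinearEquiv.coe_coe]
  constructor
  · rintro ⟨l, rfl⟩
    exact ⟨l, (hgdb l).symm⟩
  · rintro ⟨l, rfl⟩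
    exact ⟨l, hgdb l⟩

end Mover

/-! ### Wall's Theorem 2 for all even forms of positive rank, from (R) -/

section Main

/-- **Wall's Theorem 2 for EVEN forms of positive rank, from the realisation (R) of Kirby's
generators of one `S² × S²` summand, Thom's theorem and the even spin-bordism step** — WALL'S
TRICK.  For closed smooth simply connected `M`, `N` with `Q⟦μ⟧ ≅ Q⟦ν⟧`, `Q⟦μ⟧` even of rank
`k = m + 1 ≥ 1`: `X = 𝕊⁴ # m(S² × S²)`, `P = X # S² × S²` (`exists_isStabilization_sphereFour`,
`StdChart.isConnectedSum_top`), its standard filling `V` with the laws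
(`exists_standardFilling_of_isStabilization_sphereFour`) and hyperbolic basis `(βⱼ, β′ⱼ)`
(`exists_hyperbolicBasis_of_stabilisationData`); for the connected sum `N′ = M # (−N)` with its
lattice splitting, `Q_{N′} ≅ Q_P = k·H` with a hyperbolic pair
(`exists_isometryEquiv_of_splitting_of_isEven`), so (R) + Thom + the spin-bordism step give an
h-cobordism `N′ ∼ P` (`isHCobordant_of_equivalent_intersectionForm_of_evenBordism_of_realisedWallGenerators`,
the core `Q_{N′}` HAVING a hyperbolic pair); the detector `π₀ = (⟨βⱼ, ·⟩)ⱼ` of classes dying in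
`V`, `L = span {βⱼ} ⊇ Ann (ker π₀)` (`mem_span_inl_of_forall_kronecker`), and the mover
(`exists_lagrangianMover_of_realisedWallGenerators`) complete the filling clause of
`isHCobordant_of_wallFilling_of_annihilator`, which assembles Wall's `R = (V ∪_g C) ∪_{N′} W₀`.
No hyperbolic pair in `Q⟦μ⟧`, no indefiniteness and no generation theorem for `O(Q ⊕ H)` are
used; rank `0` (homotopy 4-spheres) is excluded. [cite: WallJLMS1964, Thm. 2 and §2 pp. 144–146]
[cite: Kirby1989, Ch. X, proofs of Thm. 1 (pp. 55–56) and Thm. 2 (pp. 61–62)] -/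
theorem isHCobordant_of_equivalent_intersectionForm_of_isEven_of_realisedWallGenerators
    (hR : ∀ (X : Type) [TopologicalSpace X] [T2Space X] [SecondCountableTopology X]
      [ChartedSpace (𝔼 4) X] [CompactSpace X] [IsManifold (𝓡 4) ∞ X] [SimplyConnectedSpace X]
      (ξ : HomologicalOrientation ℤ X 4)
      (_hX : (Q⟦ξ⟧).IsIndefinite ∨ Module.finrank ℤ ↥(freeCohomology ℤ X 2) ≤ 8)
      (Y : Type) [TopologicalSpace Y] [T2Space Y] [SecondCountableTopology Y]
      [ChartedSpace (𝔼 4) Y] [CompactSpace Y] [IsManifold (𝓡 4) ∞ Y]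
      (_hY : IsConnectedSum (𝓡 4) (𝓡 4) ((𝓡 2).prod (𝓡 2)) X ((𝕊 2) × (𝕊 2)) Y)
      (υ : HomologicalOrientation ℤ Y 4) (V : Type) [AddCommGroup V] (Q : BilinForm ℤ V)
      (hQ : Q.IsSymm) (_e : Q.IsometryEquiv (Q⟦ξ⟧))
      (_Θ₀ : (Q.prod hyperbolicForm).IsometryEquiv (Q⟦υ⟧)),
      ∃ Θ : (Q.prod hyperbolicForm).IsometryEquiv (Q⟦υ⟧),
        ∀ s ∈ wallGenerators hQ, IsRealisedByDiffeomorph υ (Θ.symm.trans (s.trans Θ)))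
    (h2 : isOrientedBordant_of_signature_eq.{0})
    (h3 : ∀ (M N : Type) [TopologicalSpace M] [T2Space M] [SecondCountableTopology M]
      [ChartedSpace (𝔼 4) M] [CompactSpace M] [IsManifold (𝓡 4) ∞ M] [SimplyConnectedSpace M]
      [TopologicalSpace N] [T2Space N] [SecondCountableTopology N]
      [ChartedSpace (𝔼 4) N] [CompactSpace N] [IsManifold (𝓡 4) ∞ N] [SimplyConnectedSpace N]
      (μ : HomologicalOrientation ℤ M 4) (ν : HomologicalOrientation ℤ N 4),
      (Q⟦μ⟧).IsEven → (Q⟦ν⟧).IsEven → μ.signature = ν.signature →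
      ∃ c : Cobordism 4 M N, SimplyConnectedSpace c.W ∧ IsSpin (𝓡∂ (4 + 1)) c.W)
    {M N : Type} [TopologicalSpace M] [T2Space M] [SecondCountableTopology M]
    [ChartedSpace (𝔼 4) M] [CompactSpace M] [IsManifold (𝓡 4) ∞ M] [SimplyConnectedSpace M]
    [TopologicalSpace N] [T2Space N] [SecondCountableTopology N]
    [ChartedSpace (𝔼 4) N] [CompactSpace N] [IsManifold (𝓡 4) ∞ N] [SimplyConnectedSpace N]
    (μ : HomologicalOrientation ℤ M 4) (ν : HomologicalOrientation ℤ N 4)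
    (hQ : (Q⟦μ⟧).Equivalent (Q⟦ν⟧)) (heven : (Q⟦μ⟧).IsEven)
    (hpos : 0 < Module.finrank ℤ ↥(freeCohomology ℤ M 2)) : IsHCobordant 4 M N := by
  classical
  haveI : SimplyConnectedSpace (𝕊 4) := simplyConnectedSpace_euclideanSphere (n := 4) (by norm_num)
  -- `k = m + 1`
  obtain ⟨m, hm⟩ : ∃ m, Module.finrank ℤ ↥(freeCohomology ℤ M 2) = m + 1 :=
    ⟨_, (Nat.succ_pred_eq_of_pos hpos).symm⟩
  -- `X = 𝕊⁴ # m(S² × S²)`, `P = X # S² × S²`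
  obtain ⟨X, _, _, _, _, _, _, _, hX⟩ := exists_isStabilization_sphereFour m
  obtain ⟨C, -, -⟩ := StdChart.exists_mem_source (Classical.arbitrary X)
  have hP : IsStabilization (m + 1) (𝕊 4) C.Top := hX.succ C.isConnectedSum_top
  obtain ⟨hPsc, hPc, hP2, -⟩ := exists_stabilisationCobordism (m + 1) (𝕊 4) C.Top hP
  haveI := hPsc
  haveI := hPc
  haveI := hP2
  obtain ⟨μP⟩ := isOrientableOver_of_simplyConnectedSpace ℤ C.Top (n := 4)
  -- the standard filling of `P` and the hyperbolic basis of `H²(P)/T`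
  obtain ⟨W, i1, i2, i3, i4, i5, i6, hWsc, ι, hι, hιr, Θ, hepi, hker, hform⟩ :=
    exists_standardFilling_of_isStabilization_sphereFour (m + 1) C.Top hP μP
  obtain ⟨bP, hbPl, -, hll, hrr, hlr⟩ := exists_hyperbolicBasis_of_stabilisationData μP Θ hform
  -- the lattices of `M`, `N`
  obtain ⟨hfinM, hfreeM⟩ := finite_and_free_freeCohomology_two (M := M)
  obtain ⟨hfinN, hfreeN⟩ := finite_and_free_freeCohomology_two (M := N)
  haveI := hfinM
  haveI := hfreeM
  haveI := hfinN
  haveI := hfreeN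
  obtain ⟨α⟩ := hQ
  refine isHCobordant_of_wallFilling_of_annihilator M N μ ν
    (fun N' _ _ _ _ _ _ _ π sM sN hst hQ' => ?_) ⟨α⟩
  -- the h-cobordism `N' ∼ P`: `Q_{N'} ≅ k·H = Q_P`, with a hyperbolic pair
  have hsymmP : (Q⟦μP⟧).IsSymm :=
    isSymm_intersectionForm (cupProduct_gradedComm_holds ℤ C.Top) even_two two_add_two_eq_four μP
  obtain ⟨⟨e⟩, hcore⟩ := exists_isometryEquiv_of_splitting_of_isEven μ ν π hst hQ' α heven hsymmP hm
    bP hll hrr hlr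
  obtain ⟨e₀, f₀, he₀, hf₀, hef₀⟩ := hcore (Nat.succ_pos m)
  obtain ⟨Chc, hChc⟩ :=
    isHCobordant_of_equivalent_intersectionForm_of_evenBordism_of_realisedWallGenerators hR h2 h3 π
      μP ⟨e⟩ ⟨e₀, f₀, he₀, hf₀, hef₀⟩
  -- the boundary datum `∂V = P`, the detector `π₀` and the sub-Lagrangian `L = span {βⱼ}`
  let bV : BoundaryData (𝓡∂ (4 + 1)) W (𝓡 4) :=
    { carrier := C.Top
      incl := ι
      isSmoothEmbedding := hι
      range_incl := hιr }
  let π₀ : singularHomology ℤ ℤ C.Top 2 →ₗ[ℤ] (Fin (m + 1) → ℤ) :=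
    LinearMap.pi fun j => freeKroneckerPairing C.Top 2 (bP (Sum.inl j))
  have hπ₀ : ∀ y, π₀ y = 0 ↔ ∀ j, freeKroneckerPairing C.Top 2 (bP (Sum.inl j)) y = 0 := fun y => by
    constructor
    · intro h j
      exact congrFun h j
    · intro h
      exact funext h
  refine ⟨W, i1, i2, i3, i4, i5, i6, hWsc, bV, inferInstance, inferInstance, Chc, (Fin (m + 1) → ℤ),
    inferInstance, inferInstance, inferInstance, π₀, Submodule.span ℤ (Set.range (bP ∘ Sum.inl)),
    hChc, hepi, fun y hy => ?_, fun c hc => ?_, fun βo K hKc hKi hKr => ?_⟩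
  · -- `ker π₀` dies in `V`
    exact hker y fun j => by rw [← hbPl]; exact (hπ₀ y).1 hy j
  · -- `Ann (ker π₀) ⊆ L`
    exact mem_span_inl_of_forall_kronecker bP c fun y hy => hc y ((hπ₀ y).2 hy)
  · -- the mover
    exact exists_lagrangianMover_of_realisedWallGenerators hR hX C.isConnectedSum_top μP bP hll
      hrr hlr βo K hKc hKi hKr

end Main

/-! ### Rank `0` (homotopy 4-spheres): the regluing with a full frame, and all even forms -/

section ZeroCore

set_option maxHeartbeats 800000 in
/-- **Wall's Theorem 2 for a pair with a common stabilisation and `H²(M)/T = 0` (homotopy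
4-spheres), from the realisation (R) of Kirby's generators of ONE summand** — the companion of
`isHCobordant_of_isStabilization_of_realisedWallGenerators` for the zero core: there is no
spare plane, but the `k + 1` planes of `Q_{P₁} = (k+1)·H` and the last summand `H` EXHAUST
`Q_{P₂}`, so the realised automorphism agreeing with Kirby's `A` on the `N`-side frame comes from
the full-frame transport `exists_isWordIn_wallGenerators_apply_eq_of_fullFrame` (last vector by
`1 ⊕ O(H)`); the rest of the proof is that of the companion theorem verbatim.
[cite: Kirby1989, Ch. X, proof of Thm. 1, pp. 55–56, and of Thm. 2, pp. 61–62]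
[cite: WallJLMS1964, Thm. 2, §2, p. 145] -/
theorem isHCobordant_of_isStabilization_of_realisedWallGenerators_of_zero
    (hR : ∀ (X : Type) [TopologicalSpace X] [T2Space X] [SecondCountableTopology X]
      [ChartedSpace (𝔼 4) X] [CompactSpace X] [IsManifold (𝓡 4) ∞ X] [SimplyConnectedSpace X]
      (ξ : HomologicalOrientation ℤ X 4)
      (_hX : (Q⟦ξ⟧).IsIndefinite ∨ Module.finrank ℤ ↥(freeCohomology ℤ X 2) ≤ 8)
      (Y : Type) [TopologicalSpace Y] [T2Space Y] [SecondCountableTopology Y]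
      [ChartedSpace (𝔼 4) Y] [CompactSpace Y] [IsManifold (𝓡 4) ∞ Y]
      (_hY : IsConnectedSum (𝓡 4) (𝓡 4) ((𝓡 2).prod (𝓡 2)) X ((𝕊 2) × (𝕊 2)) Y)
      (υ : HomologicalOrientation ℤ Y 4) (V : Type) [AddCommGroup V] (Q : BilinForm ℤ V)
      (hQ : Q.IsSymm) (_e : Q.IsometryEquiv (Q⟦ξ⟧))
      (_Θ₀ : (Q.prod hyperbolicForm).IsometryEquiv (Q⟦υ⟧)),
      ∃ Θ : (Q.prod hyperbolicForm).IsometryEquiv (Q⟦υ⟧),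
        ∀ s ∈ wallGenerators hQ, IsRealisedByDiffeomorph υ (Θ.symm.trans (s.trans Θ)))
    {M N : Type} [TopologicalSpace M] [T2Space M] [SecondCountableTopology M]
    [ChartedSpace (𝔼 4) M] [CompactSpace M] [IsManifold (𝓡 4) ∞ M] [SimplyConnectedSpace M]
    [TopologicalSpace N] [T2Space N] [SecondCountableTopology N]
    [ChartedSpace (𝔼 4) N] [CompactSpace N] [IsManifold (𝓡 4) ∞ N] [SimplyConnectedSpace N]
    (μ : HomologicalOrientation ℤ M 4) (ν : HomologicalOrientation ℤ N 4)
    (hQ : (Q⟦μ⟧).Equivalent (Q⟦ν⟧))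
    (h0 : ∀ x : ↥(freeCohomology ℤ M 2), x = 0)
    {k : ℕ} {P : Type} [TopologicalSpace P] [T2Space P] [ChartedSpace (𝔼 4) P]
    [IsManifold (𝓡 4) ∞ P] (hM : IsStabilization k M P) (hN : IsStabilization k N P) :
    IsHCobordant 4 M N := by
  classical
  haveI : SimplyConnectedSpace P := (exists_stabilisationCobordism k M P hM).1
  -- two more stabilisations `P₁ = P # S² × S²`, `P₂ = P₁ # S² × S²`
  obtain ⟨C₁, -, -⟩ := StdChart.exists_mem_source (Classical.arbitrary P)
  have hM₁ : IsStabilization (k + 1) M C₁.Top := hM.succ C₁.isConnectedSum_top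
  have hN₁ : IsStabilization (k + 1) N C₁.Top := hN.succ C₁.isConnectedSum_top
  obtain ⟨hsc₁, hc₁, hsnd₁, hdataM₁⟩ := exists_stabilisationCobordism (k + 1) M C₁.Top hM₁
  haveI := hsc₁
  haveI := hc₁
  haveI := hsnd₁
  obtain ⟨C₂, -, -⟩ := StdChart.exists_mem_source (Classical.arbitrary C₁.Top)
  have hM₂ : IsStabilization (k + 2) M C₂.Top := hM₁.succ C₂.isConnectedSum_top
  have hN₂ : IsStabilization (k + 2) N C₂.Top := hN₁.succ C₂.isConnectedSum_top
  obtain ⟨hsc₂, hc₂, hsnd₂, hdataM₂⟩ := exists_stabilisationCobordism (k + 2) M C₂.Top hM₂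
  obtain ⟨-, -, -, hdataN₂⟩ := exists_stabilisationCobordism (k + 2) N C₂.Top hN₂
  haveI := hsc₂
  haveI := hc₂
  haveI := hsnd₂
  -- `P₂` as a one-fold stabilisation of `P₁`: orientations `μ₂`, `μ₁` with `Q⟦μ₁⟧ ⊕ H ≅ Q⟦μ₂⟧`
  have h1 : IsStabilization 1 C₁.Top C₂.Top :=
    ((isStabilization_zero_iff C₁.Top C₁.Top).2 ⟨Diffeomorph.refl (𝓡 4) C₁.Top ∞⟩).succ
      C₂.isConnectedSum_top
  obtain ⟨-, -, -, hdata1⟩ := exists_stabilisationCobordism 1 C₁.Top C₂.Top h1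
  obtain ⟨μ₂⟩ := isOrientableOver_of_simplyConnectedSpace ℤ C₂.Top (n := 4)
  obtain ⟨μ₁₀⟩ := isOrientableOver_of_simplyConnectedSpace ℤ C₁.Top (n := 4)
  obtain ⟨-, -, Θone, -, μ₁, -, -, -, -, -, -, -, hΘone⟩ := hdata1 μ₁₀ μ₂
  -- the two halves with their lattice data
  obtain ⟨EM, bM, ΘM, εM, μ', hEMsc, hEMepi, hμ', hεM, hM1, hM2, hM3, hM4⟩ := hdataM₂ μ μ₂
  obtain ⟨EN, bN, ΘN, εN, ν', hENsc, hENepi, hν', hεN, hN1, hN2, hN3, hN4⟩ := hdataN₂ ν μ₂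
  -- the isometry of the ends and Kirby's automorphism `A`
  obtain ⟨φ⟩ := equivalent_of_stabilisationForms μ ν hQ hμ' hν' μ₂ ΘM hM4 ΘN hN4
  obtain ⟨A, hA⟩ := exists_isometryEquiv_swap μ' ν' μ₂ ΘM hM4 ΘN hN4 φ
  -- `Q_{P₁} ≅ Q⟦μ''⟧ ⊥ (k+1) H` is indefinite
  obtain ⟨-, -, Θ₁, -, μ'', -, -, -, -, -, -, -, hM4₁⟩ := hdataM₁ μ μ₁
  have hindef : (Q⟦μ₁⟧).IsIndefinite := isIndefinite_of_stabilisationForm μ'' μ₁ Θ₁ hM4₁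
  have hQ₁ : (Q⟦μ₁⟧).IsSymm :=
    isSymm_intersectionForm (cupProduct_gradedComm_holds ℤ C₁.Top) even_two two_add_two_eq_four μ₁
  /- an abstract copy `(V, Q)` of the lattice `Q_{P₁}` (coordinates in a basis, as an opaque
  additive group): the lattice lemmas are stated for the canonical `ℤ`-module structure of an
  additive group, and on an opaque `V` all instance paths are syntactic (cheap to check). -/
  haveI : Module.Finite ℤ ↥(freeCohomology ℤ C₁.Top 2) :=
    finite_freeCohomology (finite_singularCohomology_of_compactSpace_of_isPrincipalIdealRing ℤ C₁.Top 4 2)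
  haveI : Module.Free ℤ ↥(freeCohomology ℤ C₁.Top 2) :=
    free_freeCohomology (finite_singularCohomology_of_compactSpace_of_isPrincipalIdealRing ℤ C₁.Top 4 2)
  obtain ⟨V, instV, g, Q, hQg⟩ : ∃ (V : Type) (_ : AddCommGroup V)
      (g : V ≃+ ↥(freeCohomology ℤ C₁.Top 2)) (Q : BilinForm ℤ V), ∀ a b, Q a b = Q⟦μ₁⟧ (g a) (g b) :=
    ⟨(Module.Free.ChooseBasisIndex ℤ ↥(freeCohomology ℤ C₁.Top 2) → ℤ), inferInstance,
      (Module.Free.chooseBasis ℤ ↥(freeCohomology ℤ C₁.Top 2)).equivFun.symm.toAddEquiv,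
      (Q⟦μ₁⟧).comp (Module.Free.chooseBasis ℤ ↥(freeCohomology ℤ C₁.Top 2)).equivFun.symm.toLinearMap
        (Module.Free.chooseBasis ℤ ↥(freeCohomology ℤ C₁.Top 2)).equivFun.symm.toLinearMap,
      fun a b => LinearMap.BilinForm.comp_apply _ _ _ a b⟩
  have hQe : ∀ a b, Q (g.symm a) (g.symm b) = Q⟦μ₁⟧ a b := fun a b => by
    simp only [hQg, AddEquiv.apply_symm_apply]
  have hQ' : Q.IsSymm := ⟨fun a b => by simp only [hQg]; exact hQ₁.eq _ _⟩
  -- `g` is `ℤ`-linear for the module structures at hand; the isometry `(V, Q) ≅ Q_{P₁}`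
  let L : V ≃ₗ[ℤ] ↥(freeCohomology ℤ C₁.Top 2) :=
    { g with
      map_smul' := fun c x => by
        simpa only [Int.cast_id, RingHom.id_apply, AddEquiv.coe_toAddMonoidHom,
          AddEquiv.toFun_eq_coe] using map_intCast_smul g.toAddMonoidHom ℤ ℤ c x }
  have hL : ∀ x, L x = g x := fun x => rfl
  let eIso : Q.IsometryEquiv (Q⟦μ₁⟧) :=
    { L with
      map_app' := fun a b => by
        change Q⟦μ₁⟧ (g a) (g b) = Q a b
        exact (hQg a b).symm }
  obtain ⟨Θ₀⟩ := nonempty_isometryEquiv_of_stabilisationForm_one μ₁ μ₂ Θone hΘone Q g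
    fun a b => (hQg a b).symm
  -- (R) for `P₂ = P₁ # S² × S²`
  obtain ⟨Θ, hSΘ⟩ := hR C₁.Top μ₁ (Or.inl hindef) C₂.Top C₂.isConnectedSum_top μ₂ V Q hQ' eIso Θ₀
  /- the lattice `Q ⊕ H`: `k + 2` target planes (the `k + 1` planes of `Q_{P₁}` and `H`)
  and the spare plane (the hyperbolic pair of the core `Q⟦μ''⟧`) -/
  have hB : (Q.prod hyperbolicForm).IsSymm := hQ'.prod isSymm_hyperbolicForm
  -- the planes of `Q_{P₁}`
  have hvv : ∀ (a b : Fin 2) (i j : Fin (k + 1)),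
      Q.prod hyperbolicForm ((g.symm (Θ₁ (0, Pi.single i (Pi.single a 1))), 0))
          ((g.symm (Θ₁ (0, Pi.single j (Pi.single b 1))), 0)) =
        if i = j then hyperbolicForm (Pi.single a 1 : Fin 2 → ℤ) (Pi.single b 1) else 0 := by
    intro a b i j
    simp only [prod_hyperbolic_inl_inl, hQe, hM4₁, LinearMap.map_zero₂, zero_add,
      sum_hyperbolicForm_single_single]
  -- the `k + 1` target planes of `Q_{P₁} ≅ (k+1) H` (the core `Q⟦μ''⟧` being zero)
  obtain ⟨xs, hxs⟩ : ∃ xs : Fin (k + 1) → V × (Fin 2 → ℤ),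
      ∀ j, xs j = ((g.symm (Θ₁ (0, Pi.single j (Pi.single 0 1)))), 0) := ⟨_, fun j => rfl⟩
  obtain ⟨ys, hys⟩ : ∃ ys : Fin (k + 1) → V × (Fin 2 → ℤ),
      ∀ j, ys j = ((g.symm (Θ₁ (0, Pi.single j (Pi.single 1 1)))), 0) := ⟨_, fun j => rfl⟩
  have hxx : ∀ i j, Q.prod hyperbolicForm (xs i) (xs j) = 0 := fun i j => by
    rw [hxs i, hxs j, hvv, hyperbolicForm_single_zero_self, ite_self]
  have hyy : ∀ i j, Q.prod hyperbolicForm (ys i) (ys j) = 0 := fun i j => by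
    rw [hys i, hys j, hvv, hyperbolicForm_single_one_self, ite_self]
  have hxy : ∀ i j, Q.prod hyperbolicForm (xs i) (ys j) = if i = j then 1 else 0 := fun i j => by
    rw [hxs i, hys j, hvv, hyperbolicForm_single_zero_single_one]
  have hxX : ∀ j, Q.prod hyperbolicForm (xs j) hypX = 0 := fun j => by
    rw [hxs j]; exact prod_hyperbolic_inl_hypX Q _
  have hxY : ∀ j, Q.prod hyperbolicForm (xs j) hypY = 0 := fun j => by
    rw [hxs j]; exact prod_hyperbolic_inl_hypY Q _
  have hyX : ∀ j, Q.prod hyperbolicForm (ys j) hypX = 0 := fun j => by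
    rw [hys j]; exact prod_hyperbolic_inl_hypX Q _
  have hyY : ∀ j, Q.prod hyperbolicForm (ys j) hypY = 0 := fun j => by
    rw [hys j]; exact prod_hyperbolic_inl_hypY Q _
  -- the planes and `H` exhaust `Q ⊕ H`: `H²(M)/T = 0`
  have hUQ₁ : (Q⟦μ₁⟧).IsUnimodular := isPerfPair_intersectionForm_four_of_compactSpace (M := C₁.Top) μ₁
  obtain ⟨b₀, hb₀l, hb₀r⟩ := exists_modelBasis (k + 1)
  let eX : (Fin (k + 1) → Fin 2 → ℤ) →ₗ[ℤ] ↥(freeCohomology ℤ C₁.Top 2) :=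
    { toFun := fun c => Θ₁ (0, c)
      map_add' := fun c c' => by
        change Θ₁ (0, c + c') = Θ₁ (0, c) + Θ₁ (0, c')
        rw [← Θ₁.map_add, Prod.mk_add_mk, add_zero]
      map_smul' := fun n c => by
        have h := map_intCast_smul Θ₁.toAddMonoidHom ℤ ℤ n ((0 : ↥(freeCohomology ℤ M 2)), c)
        simp only [Int.cast_id, AddEquiv.coe_toAddMonoidHom, Prod.smul_mk] at h
        rw [show ((n • (0 : ↥(freeCohomology ℤ M 2))), n • c) =
          ((0 : ↥(freeCohomology ℤ M 2)), n • c) from Prod.ext (h0 _) rfl] at h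
        simpa only [RingHom.id_apply] using h }
  have heX : ∀ c, eX c = Θ₁ (0, c) := fun c => rfl
  have hspan : ∀ v : V × (Fin 2 → ℤ), (∀ j, Q.prod hyperbolicForm v (xs j) = 0) →
      (∀ j, Q.prod hyperbolicForm v (ys j) = 0) → Q.prod hyperbolicForm v hypX = 0 →
      Q.prod hyperbolicForm v hypY = 0 → v = 0 := by
    intro v hvx hvy hvX hvY
    have hv : v = (v.1, 0) := eq_inl_fst_of_ortho_hyp hvX hvY
    have hF : (Q⟦μ₁⟧ (g v.1)).comp eX = 0 := by
      refine b₀.ext fun a => ?_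
      rw [LinearMap.zero_apply, LinearMap.comp_apply, heX]
      rcases a with j | j
      · rw [hb₀l, ← hQe, g.symm_apply_apply, ← prod_hyperbolic_inl_inl (Q := Q), ← hv, ← hxs j]
        exact hvx j
      · rw [hb₀r, ← hQe, g.symm_apply_apply, ← prod_hyperbolic_inl_inl (Q := Q), ← hv, ← hys j]
        exact hvy j
    have hzero : Q⟦μ₁⟧ (g v.1) = 0 := by
      ext w
      rw [LinearMap.zero_apply, ← Θ₁.apply_symm_apply w]
      have hw : Θ₁.symm w = (0, (Θ₁.symm w).2) := Prod.ext (h0 _) rfl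
      rw [hw, ← heX, ← LinearMap.comp_apply, hF, LinearMap.zero_apply]
    have hv1 : v.1 = 0 := by
      haveI : (Q⟦μ₁⟧).IsPerfPair := hUQ₁
      have h := (LinearMap.IsPerfPair.bijective_left (Q⟦μ₁⟧)).1 (hzero.trans (map_zero _).symm)
      rw [← g.symm_apply_apply v.1, h, map_zero]
    rw [hv, hv1]
    rfl
  -- the `N`-side hyperbolic frame, pulled back to `Q ⊕ H` along `Θ`
  have hframe : ∀ (a b : Fin 2) (i j : Fin (k + 2)),
      Q⟦μ₂⟧ (ΘN (0, Pi.single i (Pi.single a 1))) (ΘN (0, Pi.single j (Pi.single b 1))) =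
        if i = j then hyperbolicForm (Pi.single a 1 : Fin 2 → ℤ) (Pi.single b 1) else 0 := by
    intro a b i j
    simp only [hN4, LinearMap.map_zero₂, zero_add, sum_hyperbolicForm_single_single]
  let u : Fin (k + 2) → _ × (Fin 2 → ℤ) := fun l => Θ.symm (ΘN (0, Pi.single l (Pi.single 0 1)))
  let u' : Fin (k + 2) → _ × (Fin 2 → ℤ) := fun l => Θ.symm (ΘN (0, Pi.single l (Pi.single 1 1)))
  have hu : ∀ i j, Q.prod hyperbolicForm (u i) (u j) = 0 := fun i j => by
    change Q.prod hyperbolicForm (Θ.symm _) (Θ.symm _) = 0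
    simp only [LinearMap.BilinForm.IsometryEquiv.map_app, hframe, hyperbolicForm_single_zero_self,
      ite_self]
  have hu' : ∀ i j, Q.prod hyperbolicForm (u' i) (u' j) = 0 := fun i j => by
    change Q.prod hyperbolicForm (Θ.symm _) (Θ.symm _) = 0
    simp only [LinearMap.BilinForm.IsometryEquiv.map_app, hframe, hyperbolicForm_single_one_self,
      ite_self]
  have huu' : ∀ i j, Q.prod hyperbolicForm (u i) (u' j) = if i = j then 1 else 0 := fun i j => by
    change Q.prod hyperbolicForm (Θ.symm _) (Θ.symm _) = _
    simp only [LinearMap.BilinForm.IsometryEquiv.map_app, hframe,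
      hyperbolicForm_single_zero_single_one]
  -- the word `φ` in the generators agreeing with `Θ⁻¹ A Θ` on the frame, and `A' = Θ φ Θ⁻¹`
  obtain ⟨φw, hφw, hφwu⟩ := exists_isWordIn_wallGenerators_apply_eq_of_fullFrame hQ' hxx hyy hxy
    hxX hxY hyX hyY hspan (Θ.trans (A.trans Θ.symm)) u u' hu hu' huu'
  have hreal : IsRealisedByDiffeomorph μ₂ (Θ.symm.trans (φw.trans Θ)) :=
    isRealisedByDiffeomorph_conj_of_isWordIn μ₂ hQ' Θ hSΘ hφw
  have hA'' : ∀ l : Fin (k + 2), (Θ.symm.trans (φw.trans Θ)) (ΘN (0, Pi.single l (Pi.single 0 1))) =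
      A (ΘN (0, Pi.single l (Pi.single 0 1))) := by
    intro l
    change Θ (φw (u l)) = _
    simp only [hφwu, LinearMap.BilinForm.IsometryEquiv.trans_apply]
    change Θ (Θ.symm (A (Θ (Θ.symm _)))) = _
    simp only [LinearMap.BilinForm.IsometryEquiv.apply_symm_apply]
  have hAδ : ∀ j l : Fin (k + 2),
      Q⟦μ₂⟧ (ΘM (0, Pi.single j (Pi.single 0 1)))
        ((Θ.symm.trans (φw.trans Θ)) (ΘN (0, Pi.single l (Pi.single 0 1)))) =
        if j = l then 1 else 0 :=
    fun j l =>
      (congrArg (fun v => Q⟦μ₂⟧ (ΘM (0, Pi.single j (Pi.single 0 1))) v) (hA'' l)).trans (hA j l)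
  -- Kirby's regluing
  exact isHCobordant_of_regluingData μ₂ EM hEMsc hEMepi bM
    (fun j => ΘM (0, Pi.single j (Pi.single 0 1))) εM hM1 hM2 hM3 hεM EN hENsc hENepi bN
    (fun j => ΘN (0, Pi.single j (Pi.single 0 1))) εN hN1 hN2 hN3 hεN _ hAδ hreal

/-- **Wall's Theorem 2 for `H²(M)/T = 0` (pairs of homotopy 4-spheres), from (R), Thom's
theorem and the even spin-bordism step**: the common stabilisation is
`exists_isStabilization_of_equivalent_intersectionForm_of_evenBordism` (the zero form is even),
the regluing `isHCobordant_of_isStabilization_of_realisedWallGenerators_of_zero`.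
[cite: WallJLMS1964, Thm. 2 (p. 141)] [cite: Kirby1989, Ch. X, proof of Thm. 1 (p. 55)] -/
theorem isHCobordant_of_equivalent_intersectionForm_of_zero_of_realisedWallGenerators
    (hR : ∀ (X : Type) [TopologicalSpace X] [T2Space X] [SecondCountableTopology X]
      [ChartedSpace (𝔼 4) X] [CompactSpace X] [IsManifold (𝓡 4) ∞ X] [SimplyConnectedSpace X]
      (ξ : HomologicalOrientation ℤ X 4)
      (_hX : (Q⟦ξ⟧).IsIndefinite ∨ Module.finrank ℤ ↥(freeCohomology ℤ X 2) ≤ 8)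
      (Y : Type) [TopologicalSpace Y] [T2Space Y] [SecondCountableTopology Y]
      [ChartedSpace (𝔼 4) Y] [CompactSpace Y] [IsManifold (𝓡 4) ∞ Y]
      (_hY : IsConnectedSum (𝓡 4) (𝓡 4) ((𝓡 2).prod (𝓡 2)) X ((𝕊 2) × (𝕊 2)) Y)
      (υ : HomologicalOrientation ℤ Y 4) (V : Type) [AddCommGroup V] (Q : BilinForm ℤ V)
      (hQ : Q.IsSymm) (_e : Q.IsometryEquiv (Q⟦ξ⟧))
      (_Θ₀ : (Q.prod hyperbolicForm).IsometryEquiv (Q⟦υ⟧)),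
      ∃ Θ : (Q.prod hyperbolicForm).IsometryEquiv (Q⟦υ⟧),
        ∀ s ∈ wallGenerators hQ, IsRealisedByDiffeomorph υ (Θ.symm.trans (s.trans Θ)))
    (h2 : isOrientedBordant_of_signature_eq.{0})
    (h3 : ∀ (M N : Type) [TopologicalSpace M] [T2Space M] [SecondCountableTopology M]
      [ChartedSpace (𝔼 4) M] [CompactSpace M] [IsManifold (𝓡 4) ∞ M] [SimplyConnectedSpace M]
      [TopologicalSpace N] [T2Space N] [SecondCountableTopology N]
      [ChartedSpace (𝔼 4) N] [CompactSpace N] [IsManifold (𝓡 4) ∞ N] [SimplyConnectedSpace N]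
      (μ : HomologicalOrientation ℤ M 4) (ν : HomologicalOrientation ℤ N 4),
      (Q⟦μ⟧).IsEven → (Q⟦ν⟧).IsEven → μ.signature = ν.signature →
      ∃ c : Cobordism 4 M N, SimplyConnectedSpace c.W ∧ IsSpin (𝓡∂ (4 + 1)) c.W)
    {M N : Type} [TopologicalSpace M] [T2Space M] [SecondCountableTopology M]
    [ChartedSpace (𝔼 4) M] [CompactSpace M] [IsManifold (𝓡 4) ∞ M] [SimplyConnectedSpace M]
    [TopologicalSpace N] [T2Space N] [SecondCountableTopology N]
    [ChartedSpace (𝔼 4) N] [CompactSpace N] [IsManifold (𝓡 4) ∞ N] [SimplyConnectedSpace N]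
    (μ : HomologicalOrientation ℤ M 4) (ν : HomologicalOrientation ℤ N 4)
    (hQ : (Q⟦μ⟧).Equivalent (Q⟦ν⟧)) (h0 : ∀ x : ↥(freeCohomology ℤ M 2), x = 0) :
    IsHCobordant 4 M N := by
  obtain ⟨k, P, _, _, _, _, _, _, hM, hN⟩ :=
    exists_isStabilization_of_equivalent_intersectionForm_of_evenBordism h2 h3 M N μ ν hQ
  exact isHCobordant_of_isStabilization_of_realisedWallGenerators_of_zero hR μ ν hQ h0 hM hN

/-- **Wall's Theorem 2 for ALL EVEN forms, from (R), Thom's theorem and the even spin-bordism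
step** — the union of `…_of_isEven_of_realisedWallGenerators` (positive rank, Wall's trick) and
`…_of_zero_of_realisedWallGenerators` (rank `0`, full-frame regluing): no hyperbolic pair, no
indefiniteness, no generation theorem for `O(Q ⊕ H)`, no rank condition.
[cite: WallJLMS1964, Thm. 2 (p. 141) and §2 pp. 144–146] -/
theorem isHCobordant_of_equivalent_intersectionForm_of_isEven_of_realisedWallGenerators'
    (hR : ∀ (X : Type) [TopologicalSpace X] [T2Space X] [SecondCountableTopology X]
      [ChartedSpace (𝔼 4) X] [CompactSpace X] [IsManifold (𝓡 4) ∞ X] [SimplyConnectedSpace X]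
      (ξ : HomologicalOrientation ℤ X 4)
      (_hX : (Q⟦ξ⟧).IsIndefinite ∨ Module.finrank ℤ ↥(freeCohomology ℤ X 2) ≤ 8)
      (Y : Type) [TopologicalSpace Y] [T2Space Y] [SecondCountableTopology Y]
      [ChartedSpace (𝔼 4) Y] [CompactSpace Y] [IsManifold (𝓡 4) ∞ Y]
      (_hY : IsConnectedSum (𝓡 4) (𝓡 4) ((𝓡 2).prod (𝓡 2)) X ((𝕊 2) × (𝕊 2)) Y)
      (υ : HomologicalOrientation ℤ Y 4) (V : Type) [AddCommGroup V] (Q : BilinForm ℤ V)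
      (hQ : Q.IsSymm) (_e : Q.IsometryEquiv (Q⟦ξ⟧))
      (_Θ₀ : (Q.prod hyperbolicForm).IsometryEquiv (Q⟦υ⟧)),
      ∃ Θ : (Q.prod hyperbolicForm).IsometryEquiv (Q⟦υ⟧),
        ∀ s ∈ wallGenerators hQ, IsRealisedByDiffeomorph υ (Θ.symm.trans (s.trans Θ)))
    (h2 : isOrientedBordant_of_signature_eq.{0})
    (h3 : ∀ (M N : Type) [TopologicalSpace M] [T2Space M] [SecondCountableTopology M]
      [ChartedSpace (𝔼 4) M] [CompactSpace M] [IsManifold (𝓡 4) ∞ M] [SimplyConnectedSpace M]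
      [TopologicalSpace N] [T2Space N] [SecondCountableTopology N]
      [ChartedSpace (𝔼 4) N] [CompactSpace N] [IsManifold (𝓡 4) ∞ N] [SimplyConnectedSpace N]
      (μ : HomologicalOrientation ℤ M 4) (ν : HomologicalOrientation ℤ N 4),
      (Q⟦μ⟧).IsEven → (Q⟦ν⟧).IsEven → μ.signature = ν.signature →
      ∃ c : Cobordism 4 M N, SimplyConnectedSpace c.W ∧ IsSpin (𝓡∂ (4 + 1)) c.W)
    {M N : Type} [TopologicalSpace M] [T2Space M] [SecondCountableTopology M]
    [ChartedSpace (𝔼 4) M] [CompactSpace M] [IsManifold (𝓡 4) ∞ M] [SimplyConnectedSpace M]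
    [TopologicalSpace N] [T2Space N] [SecondCountableTopology N]
    [ChartedSpace (𝔼 4) N] [CompactSpace N] [IsManifold (𝓡 4) ∞ N] [SimplyConnectedSpace N]
    (μ : HomologicalOrientation ℤ M 4) (ν : HomologicalOrientation ℤ N 4)
    (hQ : (Q⟦μ⟧).Equivalent (Q⟦ν⟧)) (heven : (Q⟦μ⟧).IsEven) : IsHCobordant 4 M N := by
  rcases Nat.eq_zero_or_pos (Module.finrank ℤ ↥(freeCohomology ℤ M 2)) with hz | hpos
  · refine isHCobordant_of_equivalent_intersectionForm_of_zero_of_realisedWallGenerators hR h2 h3 μ ν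
      hQ fun x => ?_
    obtain ⟨hfin, hfree⟩ := finite_and_free_freeCohomology_two (M := M)
    haveI := hfin
    haveI := hfree
    obtain ⟨a, ha, hax⟩ := (Module.finrank_eq_zero_iff (R := ℤ)).1 hz x
    exact (smul_eq_zero.1 hax).resolve_left ha
  · exact isHCobordant_of_equivalent_intersectionForm_of_isEven_of_realisedWallGenerators hR h2 h3 μ ν
      hQ heven hpos

/-- **The even half of Wall's Theorem 2 from Kirby's Thm. X.2, Thom's theorem and the even
spin-bordism step, WITHOUT a hyperbolic pair** (X.2 ⇒ (R), `realisedWallGenerators_of_thmX2`):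
the hcore-free even reading for the discharge of the fact (`HCobordismWallSpinCase.lean`).
[cite: WallJLMS1964, Thm. 2 (p. 141)] [cite: Kirby1989, Ch. X, Thms. 1, 2] -/
theorem isHCobordant_of_equivalent_intersectionForm_of_isEven_of_thmX2_of_evenBordism
    (h1 : exists_diffeomorph_freeCohomologyMap_eq_of_isometryEquiv)
    (h2 : isOrientedBordant_of_signature_eq.{0})
    (h3 : ∀ (M N : Type) [TopologicalSpace M] [T2Space M] [SecondCountableTopology M]
      [ChartedSpace (𝔼 4) M] [CompactSpace M] [IsManifold (𝓡 4) ∞ M] [SimplyConnectedSpace M]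
      [TopologicalSpace N] [T2Space N] [SecondCountableTopology N]
      [ChartedSpace (𝔼 4) N] [CompactSpace N] [IsManifold (𝓡 4) ∞ N] [SimplyConnectedSpace N]
      (μ : HomologicalOrientation ℤ M 4) (ν : HomologicalOrientation ℤ N 4),
      (Q⟦μ⟧).IsEven → (Q⟦ν⟧).IsEven → μ.signature = ν.signature →
      ∃ c : Cobordism 4 M N, SimplyConnectedSpace c.W ∧ IsSpin (𝓡∂ (4 + 1)) c.W)
    {M N : Type} [TopologicalSpace M] [T2Space M] [SecondCountableTopology M]
    [ChartedSpace (𝔼 4) M] [CompactSpace M] [IsManifold (𝓡 4) ∞ M] [SimplyConnectedSpace M]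
    [TopologicalSpace N] [T2Space N] [SecondCountableTopology N]
    [ChartedSpace (𝔼 4) N] [CompactSpace N] [IsManifold (𝓡 4) ∞ N] [SimplyConnectedSpace N]
    (μ : HomologicalOrientation ℤ M 4) (ν : HomologicalOrientation ℤ N 4)
    (hQ : (Q⟦μ⟧).Equivalent (Q⟦ν⟧)) (heven : (Q⟦μ⟧).IsEven) : IsHCobordant 4 M N :=
  isHCobordant_of_equivalent_intersectionForm_of_isEven_of_realisedWallGenerators'
    (realisedWallGenerators_of_thmX2 h1) h2 h3 μ ν hQ heven

end ZeroCore

end Literature.Topology.FourManifolds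

end
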